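/-
Copyright (c) 2026 the pub-hodgecm-mathlib formalisation cell (harness21).  Prover seat hodgecm-mathlib-LA3-p01 (g0), «GO 500» half A line L3
(socket `stub_FROB`, road ROOF → `stub_ROOF0`), organ #1b «THE EXACT SERRE-TWISTED POLARISATION EXISTS»; 2026-09-02.
-/
import Literature.AlgebraicGeometry.AbelianSchemes.SerreTwistCoverOrientation
import Literature.AlgebraicGeometry.AbelianSchemes.HomDescentMulNOfNeZero
import Literature.AlgebraicGeometry.AbelianSchemes.AbelianSchemeHomDescentFlatSurjective
import Literature.AlgebraicGeometry.AbelianSchemes.SerreTensorRecognitionOfPoints   -- ★ `natCast_mem_of_quasiInverse`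
import HarnessLib

/-!
# The EXACT Serre-twisted polarisation `λ′ : A ⊗_𝒪 𝔟 → (A ⊗_𝒪 𝔟)^` with `ψ_P^*λ′ = N·λ` EXISTS under a Rosati pair for `𝔭`
# ([MumfordAV1970] §23 Thm. 2 and its Cor.; [RapoportSmithlingZhang2020Diagonal] §3.2, (4.23); B. Conrad, *Gross–Zagier revisited* §7)

Topic `AlgebraicGeometry/AbelianSchemes`, namespace `Literature.AlgebraicGeometry.AbelianSchemes.AbelianSchemeOver`.  THEOREMS ONLY (no definition, no named fact,
no `instance`, no notation, no `sorry`); base `S` reduced and locally Noetherian (where ★ `dualIsogenyOver` is a homomorphism).  Cell `hodgecm-mathlib` (D-0151),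
F0∕P6 «MOD», «GO 500» line L3 (socket `stub_FROB`), road ROOF → `stub_ROOF0` (LEAD F0P6-plan (g3) L-DEAL v1 §L3; LA3-plan (g0) deal v1): the EXISTENCE clause that ★
`SerreTwistPolarization` (γ2, p846320) §2 leaves open («EXISTENCE is NOT proved here (it is the descent of `c·λ` along `ψ_P`, whose kernel `A[𝔞]` is `e^{cλ}`-isotropic
when `c ∈ 𝔞𝔞̄`)»), in the PAIRING-FREE form the tree's descent tools consume, with the scalar `c = N` of the quasi-inverse (`N ∈ 𝔭`; model `N = p ∈ 𝔭_w`) — the scalar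
the downstairs roof `Roof₀` of the P6a datum pins on BOTH legs ((r3₀) `c̄^*λ_B̄ = p·λ_{x̄″}`), so that the middle `B̄ := (𝒜 ⊗ 𝔭_w⁻¹)_{x̄″}` of ★ `SerreTranslateCoverLeg`
carries `λ_B̄ := λ′_{x̄″}` (the pull-back normalisation ★ `serreTwistLamPull` has scalar `N²` and does not serve).  `--supports stmt-HodgeConjecture-24832`, count-neutral.
HONEST LABEL: HC_CM is proved only modulo the cell's 2 remaining named inputs (hLiu418 24832, h413 24833) until rung 0 closes; this file discharges none of them.

## Mathematics

Setting of ★ `SerreTwistPolarization`: `A∕S` commutative abelian scheme with a ring action `ι : 𝒪 → End(A)`, `𝔟 = E′·𝒪ᵐ` (`E′² = E′`) with `P ∈ 𝔟` (`E′P = P`) whose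
coordinates generate the ideal `𝔭`, a quasi-inverse row `Q` (`QE′ = Q`, `QP = N`, `PQ = N·E′`, `N ≠ 0`) — so `N = QP ∈ 𝔭` (§1) —, `ψ_P : A → A ⊗ 𝔟` (kernel `A[𝔭]`,
fppf), `ψ′ : A ⊗ 𝔟 → A` (`ψ_P ψ′ = [N]`, `ψ′ ψ_P = [N]`), dual pairs `D`, `D_𝔟` with the unit hypotheses, a polarisation `λ`.  A **ROSATI PAIR FOR `𝔭`** is `(a, b) ∈ 𝒪²`
with `ι(a) ≫ λ = λ ≫ ι(b)^∨`, `1 − a ∈ 𝔭`, `b ∈ 𝔭` — in the CM model (`𝒪 = 𝒪_F`, Rosati involution = complex conjugation, `𝔭 = 𝔭_w` with `𝔭_w + 𝔭_{w̄} = 𝒪_F`):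
`a ∈ 𝔭_{w̄}`, `a ≡ 1 (mod 𝔭_w)`, `b = ā ∈ 𝔭_w`, and `ι(a) ≫ λ = λ ≫ ι(ā)^∨` is the Kottwitz–RSZ compatibility ([Kottwitz1992] §5; the `RGDInputsAt.rosati` field).

THEOREM (§2–§3).  `λ^{pull} := ψ′ ≫ λ ≫ ψ′^∨` KILLS `(A ⊗ 𝔟)[N]` on ALL `T`-points; hence (★ `HomDescentMulNOfNeZero`, any characteristic) `λ^{pull} = [N] ≫ λ′` for a
UNIQUE homomorphism `λ′`, and `λ′` is `ψ_P`-EXACT WITH SCALAR `N`: `ψ_P ≫ λ′ ≫ ψ_P^∨ = λ ≫ [N]` (★ `IsExactTwistPol … N λ′`); it is the unique such (★ `IsExactTwistPol.eq`),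
`λ′ ≫ [N] = λ^{pull}`, and it is `𝒪`-compatible when `λ` is (★ `serreAction_i_comp_of_isExactTwistPol`).  PROOF of the kill (pairing-free isotropy): for `u ∈ (A⊗𝔟)(T)` with
`u^N = 1` put `t := u ≫ ψ′ ∈ A(T)`; then `t ≫ ψ_P = u^N = 1`, so `t ∈ A[𝔭](T)` (★ kernel law), whence `t ≫ ι(a) = t` (`a − 1 ∈ 𝔭`) and `t^N = t ≫ ι(N) = 1` (`N ∈ 𝔭`).  Now
`u ≫ λ^{pull} = t ≫ λ ≫ ψ′^∨ = t ≫ ι(a) ≫ λ ≫ ψ′^∨ = t ≫ λ ≫ ι(b)^∨ ≫ ψ′^∨ = t ≫ λ ≫ (ψ′ ≫ ι(b))^∨`; since `b ∈ 𝔭`, `ι(b)` kills `Ker ψ_P` and DESCENDS, `ι(b) = ψ_P ≫ d`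
(★ `existsUnique_comp_eq_of_forall_comp_eq_one`), so `ψ′ ≫ ι(b) = [N] ≫ d` and `(ψ′ ≫ ι(b))^∨ = d^∨ ≫ [N]`; thus `u ≫ λ^{pull} = (t ≫ λ ≫ d^∨)^N = t^N ≫ λ ≫ d^∨ = 1`.
This is [MumfordAV1970] §23 (descent of a polarisation along an isogeny with isotropic kernel) for the Serre cover, with the Weil-pairing isotropy replaced by its
Rosati shadow.

## Contents
* §1 (`N ∈ 𝔭` is ★ `natCast_mem_of_quasiInverse`, p846733) `comp_i_eq_self_of_sub_mem` (`t ∈ A[𝔭]`, `1 − a ∈ 𝔭` ⟹ `t ≫ ι(a) = t`), `exists_serreTranslate_comp_eq_i_of_mem`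
  (`b ∈ 𝔭` ⟹ `ι(b) = ψ_P ≫ d`, `d` a homomorphism).
* §2 **`serreTwistLamPull_kills_mulN_torsion`** (`u^N = 1 ⟹ u ≫ λ^{pull} = 1`).
* §3 **`exists_isExactTwistPol_of_rosatiPair`** (`∃ λ′, IsMonHom λ′ ∧ IsExactTwistPol … N λ′ ∧ [N] ≫ λ′ = λ^{pull}`), `existsUnique_isExactTwistPol_of_rosatiPair`.

## References
* [MumfordAV1970] D. Mumford, *Abelian Varieties* (1970), §23 Thm. 2 (p. 231) and Cor. (descent of polarisations), §7 Thm. 4 (p. 72), §15 Thm. 1 (p. 143).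
* [RapoportSmithlingZhang2020Diagonal] M. Rapoport, B. Smithling, W. Zhang (2020), §3.2 (p. 11), §4.3 (4.23) (p. 21) (the `λ`-exact Serre twist `A ⊗ 𝔞⁻¹`).
* [Conrad2004GrossZagier] B. Conrad, *Gross–Zagier revisited*, MSRI Publ. 49 (2004), §7 (Thm. 7.5).
* [Kottwitz1992] R. Kottwitz, *Points on some Shimura varieties over finite fields*, JAMS 5 (1992), §5 (p. 390) (the Rosati condition `ι(a)^* = ι(ā)`).
-/

set_option autoImplicit false

noncomputable section

universe u

open CategoryTheory CategoryTheory.Limits AlgebraicGeometry MonoidalCategory CartesianMonoidalCategory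
open scoped MonObj

namespace Literature.AlgebraicGeometry.AbelianSchemes

namespace AbelianSchemeOver

set_option backward.isDefEq.respectTransparency false

variable {S : Scheme.{u}} {A : AbelianSchemeOver S} {O : Type*} [CommRing O] (act : A.RingAction O) [IsCommMonObj A.X]
  {m : ℕ} (E' : Matrix (Fin m) (Fin m) O) (hE' : E' * E' = E') (P : Matrix (Fin m) (Fin 1) O) (Q : Matrix (Fin 1) (Fin m) O) {N : ℕ}

/-! ## §1 Bookkeeping: points of `A[𝔭]` are fixed by `ι(a)` for `a ≡ 1 (mod 𝔭)`; `ι(b)`, `b ∈ 𝔭`, descends along `ψ_P` (`N ∈ 𝔭` is ★ `natCast_mem_of_quasiInverse`) -/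

-- `N = QP ∈ 𝔭` is ★ `natCast_mem_of_quasiInverse` (`SerreTensorRecognitionOfPoints`, p846733), cited by name.

/-- **A point of `A[𝔭]` is fixed by `ι(a)` when `a ≡ 1 (mod 𝔭)`**: `(∀ x ∈ 𝔭, t ≫ ι(x) = 1) → 1 − a ∈ 𝔭 → t ≫ ι(a) = t` (`ι(a) = ι(1)·ι(a − 1)` pointwise).
[cite: Kottwitz1992, §5 (p. 390)] -/
theorem comp_i_eq_self_of_sub_mem {𝔭 : Ideal O} {T : Over S} (t : T ⟶ A.X) (ht : ∀ x ∈ 𝔭, t ≫ act.i x = 1) {a : O} (ha : 1 - a ∈ 𝔭) :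
    t ≫ act.i a = t := by
  have h1 : a = 1 + (a - 1) := by ring
  have h2 : a - 1 ∈ 𝔭 := by rw [← neg_sub]; exact 𝔭.neg_mem ha
  rw [h1, RingAction.comp_i_add, (RingAction.comp_i_zero_one act t).2, ht _ h2, mul_one]

/-- **`ι(b)` DESCENDS ALONG `ψ_P` for `b ∈ 𝔭`**: `ι(b)` kills `Ker ψ_P = A[𝔭]` on points, so `ι(b) = ψ_P ≫ d` for a homomorphism `d : A ⊗ 𝔟 → A`
(★ `existsUnique_comp_eq_of_forall_comp_eq_one`; the Serre presentation of `𝔭`). [cite: MumfordAV1970, §7 Thm. 4 (p. 72)] [cite: Conrad2004GrossZagier, §7 (Thm. 7.5)] -/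
theorem exists_serreTranslate_comp_eq_i_of_mem (hN : N ≠ 0) (hP : E' * P = P) (hQ : Q * E' = Q)
    (hQP : Q * P = Matrix.scalar (Fin 1) (N : O)) (hPQ : P * Q = Matrix.scalar (Fin m) (N : O) * E')
    {𝔭 : Ideal O} (h𝔭 : Ideal.span (Set.range fun k => P k 0) = 𝔭) {b : O} (hb : b ∈ 𝔭) :
    ∃ d : (serreTensor act E' hE').X ⟶ A.X, IsMonHom d ∧ serreTranslate act E' hE' P ≫ d = act.i b := by
  haveI := isMonHom_serreTranslate act E' hE' P
  haveI := act.isMonHom b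
  haveI := flat_serreTranslate_left act E' hE' P Q hN hP hQ hQP hPQ
  haveI := surjective_serreTranslate_left act E' hE' P Q hN hP hQ hQP hPQ
  haveI := quasiCompact_serreTranslate_left act E' hE' P Q hN hP hQ hQP hPQ
  obtain ⟨d, hd, hfac, -⟩ := A.exists_isMonHom_comp_eq_of_forall_comp_eq_one (serreTranslate act E' hE' P) (act.i b)
    fun T t ht => (comp_serreTranslate_eq_one_iff_forall_mem act E' hE' P hP h𝔭 t).mp ht b hb
  exact ⟨d, hd, hfac⟩

/-! ## §2 The pull-back normalisation kills the `N`-torsion of `A ⊗ 𝔟` -/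

variable (D : A.DualPair) (Db : (serreTensor act E' hE').DualPair)
  (hD : Nonempty ((Scheme.Modules.pullback (DualPair.unitHatSlice D)).obj D.P ≅ SheafOfModules.unit _))
  (hDb : Nonempty ((Scheme.Modules.pullback (DualPair.unitHatSlice Db)).obj Db.P ≅ SheafOfModules.unit _))
  (pol : A.Polarization D)

include hD hDb in
/-- **`λ^{pull} = ψ′ ≫ λ ≫ ψ′^∨` KILLS `(A ⊗ 𝔟)[N]` ON ALL `T`-POINTS, given a Rosati pair `(a, b)` for `𝔭`** (`ι(a) ≫ λ = λ ≫ ι(b)^∨`, `1 − a ∈ 𝔭`, `b ∈ 𝔭`):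
`u^N = 1 ⟹ u ≫ λ^{pull} = 1`.  Pairing-free isotropy of `A[𝔭]` for `N·λ`: with `t := u ≫ ψ′ ∈ A[𝔭](T)`, `u ≫ λ^{pull} = t ≫ ι(a) ≫ λ ≫ ψ′^∨ = t ≫ λ ≫ (ψ′ ≫ ι(b))^∨ =
(t ≫ λ ≫ d^∨)^N = t^N ≫ λ ≫ d^∨ = 1` where `ι(b) = ψ_P ≫ d`. [cite: MumfordAV1970, §23 Thm. 2 (p. 231)] [cite: RapoportSmithlingZhang2020Diagonal, §3.2 (p. 11) and §4.3 (4.23) (p. 21)]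
[cite: Kottwitz1992, §5 (p. 390)] -/
theorem serreTwistLamPull_kills_mulN_torsion [IsReduced S] [IsLocallyNoetherian S] (hN : N ≠ 0) (hP : E' * P = P) (hQ : Q * E' = Q)
    (hQP : Q * P = Matrix.scalar (Fin 1) (N : O)) (hPQ : P * Q = Matrix.scalar (Fin m) (N : O) * E')
    {𝔭 : Ideal O} (h𝔭 : Ideal.span (Set.range fun k => P k 0) = 𝔭) {a b : O}
    (hab : haveI := act.isMonHom b; act.i a ≫ pol.lam = pol.lam ≫ DualPair.dualIsogenyOver (act.i b) D D)
    (ha : 1 - a ∈ 𝔭) (hb : b ∈ 𝔭) ⦃T : Over S⦄ (u : T ⟶ (serreTensor act E' hE').X) (hu : u ^ N = 1) :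
    u ≫ serreTwistLamPull act E' hE' Q D Db pol = 1 := by
  haveI := isMonHom_serreTranslate act E' hE' P
  haveI := isMonHom_serreTranslateInv act E' hE' Q
  haveI := act.isMonHom b
  haveI := pol.isMonHom
  haveI hcommb : IsCommMonObj (serreTensor act E' hE').X := isCommMonObj_serreTensor act E' hE'
  -- the point `t := u ≫ ψ′` lies in `A[𝔭]`
  set t : T ⟶ A.X := u ≫ serreTranslateInv act E' hE' Q with ht_def
  have htψ : t ≫ serreTranslate act E' hE' P = 1 := by
    rw [ht_def, Category.assoc, serreTranslateInv_comp_serreTranslate act E' hE' P Q hP hQ hPQ, MonObj.comp_pow, Category.comp_id, hu]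
  have ht𝔭 : ∀ x ∈ 𝔭, t ≫ act.i x = 1 := (comp_serreTranslate_eq_one_iff_forall_mem act E' hE' P hP h𝔭 t).mp htψ
  have hta : t ≫ act.i a = t := comp_i_eq_self_of_sub_mem act t ht𝔭 ha
  have htN : t ^ N = 1 := by
    have h := ht𝔭 (N : O) (natCast_mem_of_quasiInverse P Q hQP h𝔭)
    rwa [RingAction.i_natCast, MonObj.comp_pow, Category.comp_id] at h
  -- `ι(b) = ψ_P ≫ d`
  obtain ⟨d, hd, hfac⟩ := exists_serreTranslate_comp_eq_i_of_mem act E' hE' P Q hN hP hQ hQP hPQ h𝔭 hb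
  haveI := hd
  haveI : IsMonHom ((serreTensor act E' hE').mulN N) := (serreTensor act E' hE').isMonHom_mulN N
  haveI : IsMonHom (DualPair.dualIsogenyOver d Db D) := DualPair.isMonHom_dualIsogenyOver d Db D hD hDb
  -- `(ψ′ ≫ ι(b))^∨ = d^∨ ≫ [N]`
  have hψ'b : serreTranslateInv act E' hE' Q ≫ act.i b = (serreTensor act E' hE').mulN N ≫ d := by
    rw [← hfac, ← Category.assoc, serreTranslateInv_comp_serreTranslate act E' hE' P Q hP hQ hPQ, mulN_def]
  have hdual : DualPair.dualIsogenyOver (act.i b) D D ≫ DualPair.dualIsogenyOver (serreTranslateInv act E' hE' Q) Db D =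
      DualPair.dualIsogenyOver d Db D ≫ Db.hat.mulN N := by
    rw [← DualPair.dualIsogenyOver_comp (serreTranslateInv act E' hE' Q) (act.i b) Db D D,
      DualPair.dualIsogenyOver_congr Db D (h₂ := by infer_instance) hψ'b,
      DualPair.dualIsogenyOver_comp ((serreTensor act E' hE').mulN N) d Db Db D, Db.dualIsogenyOver_mulN hDb N]
  -- the computation
  calc u ≫ serreTwistLamPull act E' hE' Q D Db pol
      = t ≫ pol.lam ≫ DualPair.dualIsogenyOver (serreTranslateInv act E' hE' Q) Db D := by
          rw [serreTwistLamPull_def, ht_def, Category.assoc]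
    _ = t ≫ act.i a ≫ pol.lam ≫ DualPair.dualIsogenyOver (serreTranslateInv act E' hE' Q) Db D := by
          rw [← Category.assoc t (act.i a), hta]
    _ = t ≫ pol.lam ≫ DualPair.dualIsogenyOver d Db D ≫ Db.hat.mulN N := by
          rw [reassoc_of% hab, hdual]
    _ = (t ≫ pol.lam ≫ DualPair.dualIsogenyOver d Db D) ^ N := by
          rw [mulN_def, ← Category.assoc, ← Category.assoc, MonObj.comp_pow, Category.comp_id, Category.assoc]
    _ = 1 := by
          rw [← Category.assoc, ← MonObj.pow_comp, ← MonObj.pow_comp, htN, MonObj.one_comp, MonObj.one_comp]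

/-! ## §3 The exact twisted polarisation with scalar `N` exists (and is unique) -/

include hD hDb in
/-- **THE EXACT SERRE-TWISTED POLARISATION EXISTS.**  Over a reduced locally Noetherian base, given a Rosati pair `(a, b)` for `𝔭` (`ι(a) ≫ λ = λ ≫ ι(b)^∨`, `1 − a ∈ 𝔭`,
`b ∈ 𝔭`), there is a homomorphism `λ′ : A ⊗ 𝔟 → (A ⊗ 𝔟)^` with **`ψ_P ≫ λ′ ≫ ψ_P^∨ = λ ≫ [N]`** (★ `IsExactTwistPol … N λ′`) and `[N] ≫ λ′ = λ^{pull}`: descend `λ^{pull}`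
through `[N]` (§2 + ★ `exists_isMonHom_pow_id_comp_eq_of_forall_pow_eq_one_of_ne_zero`, any characteristic), then cancel `[N]` on the right in
`ψ_P ≫ λ^{pull} ≫ ψ_P^∨ = λ ≫ [N²]` (★ `isExactTwistPol_serreTwistLamPull`, ★ `eq_of_comp_mulN_eq`).  In the CM model this is the `λ`-exact Serre twist
`(A ⊗ 𝔭_w⁻¹, p⁻¹·λ^{pull})` of [RapoportSmithlingZhang2020Diagonal] (4.23). [cite: MumfordAV1970, §23 Thm. 2 (p. 231)] [cite: RapoportSmithlingZhang2020Diagonal, §4.3 (4.23) (p. 21)] -/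
theorem exists_isExactTwistPol_of_rosatiPair [IsReduced S] [IsLocallyNoetherian S] (hN : N ≠ 0) (hP : E' * P = P) (hQ : Q * E' = Q)
    (hQP : Q * P = Matrix.scalar (Fin 1) (N : O)) (hPQ : P * Q = Matrix.scalar (Fin m) (N : O) * E')
    {𝔭 : Ideal O} (h𝔭 : Ideal.span (Set.range fun k => P k 0) = 𝔭) {a b : O}
    (hab : haveI := act.isMonHom b; act.i a ≫ pol.lam = pol.lam ≫ DualPair.dualIsogenyOver (act.i b) D D)
    (ha : 1 - a ∈ 𝔭) (hb : b ∈ 𝔭) :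
    ∃ lam' : (serreTensor act E' hE').X ⟶ Db.hat.X, IsMonHom lam' ∧ IsExactTwistPol act E' hE' P D Db pol N lam' ∧
      ((𝟙 (serreTensor act E' hE').X) ^ N) ≫ lam' = serreTwistLamPull act E' hE' Q D Db pol := by
  haveI := isMonHom_serreTranslate act E' hE' P
  haveI hcommb : IsCommMonObj (serreTensor act E' hE').X := isCommMonObj_serreTensor act E' hE'
  haveI := isMonHom_serreTwistLamPull act E' hE' Q D Db hD hDb pol
  haveI := pol.isMonHom
  haveI : IsCommMonObj D.hat.X := D.hat.isCommMonObj_of_isReduced_base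
  haveI : IsCommMonObj Db.hat.X := Db.hat.isCommMonObj_of_isReduced_base
  haveI : IsMonHom (D.hat.mulN N) := D.hat.isMonHom_mulN N
  haveI : IsMonHom (DualPair.dualIsogenyOver (serreTranslate act E' hE' P) D Db) :=
    DualPair.isMonHom_dualIsogenyOver (serreTranslate act E' hE' P) D Db hDb hD
  -- descend `λ^{pull}` through `[N]`
  obtain ⟨lam', hmon, hfac, -⟩ := (serreTensor act E' hE').exists_isMonHom_pow_id_comp_eq_of_forall_pow_eq_one_of_ne_zero
    (serreTwistLamPull act E' hE' Q D Db pol) hN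
    (fun T u hu => serreTwistLamPull_kills_mulN_torsion act E' hE' P Q D Db hD hDb pol hN hP hQ hQP hPQ h𝔭 hab ha hb u hu)
  haveI := hmon
  refine ⟨lam', hmon, ?_, hfac⟩
  -- `ψ ≫ λ^{pull} ≫ ψ^∨ = λ ≫ [N²]` and `λ^{pull} = lam' ≫ [N]`
  have hpull := isExactTwistPol_serreTwistLamPull act E' hE' P Q D Db hD pol hP hQ hQP
  rw [isExactTwistPol_iff] at hpull ⊢
  have hfac' : serreTwistLamPull act E' hE' Q D Db pol = lam' ≫ Db.hat.mulN N := by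
    rw [← hfac, mulN_def, MonObj.pow_comp, Category.id_comp, MonObj.comp_pow, Category.comp_id]
  -- `[N]` commutes past `ψ^∨`
  have hk : Db.hat.mulN N ≫ DualPair.dualIsogenyOver (serreTranslate act E' hE' P) D Db =
      DualPair.dualIsogenyOver (serreTranslate act E' hE' P) D Db ≫ D.hat.mulN N := by
    rw [mulN_def, mulN_def, MonObj.pow_comp, Category.id_comp, MonObj.comp_pow, Category.comp_id]
  rw [hfac', Category.assoc, hk] at hpull
  -- cancel `[N]` on the right
  have hNN : D.hat.mulN N ≫ D.hat.mulN N = D.hat.mulN (N ^ 2) := by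
    rw [mulN_def, mulN_def, MonObj.comp_pow, Category.comp_id, ← pow_mul, sq]
  refine eq_of_comp_mulN_eq A hN _ _ ?_
  rw [Category.assoc, Category.assoc, hpull, Category.assoc, hNN]

include hD hDb in
/-- **… AND IT IS UNIQUE** (★ `IsExactTwistPol.eq`): `∃! λ′` homomorphism with `ψ_P ≫ λ′ ≫ ψ_P^∨ = λ ≫ [N]` (packaged as a subtype-free `∃!` on the conjunction).
[cite: MumfordAV1970, §23 Thm. 2 (p. 231)] [cite: RapoportSmithlingZhang2020Diagonal, §4.3 (4.23) (p. 21)] -/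
theorem existsUnique_isExactTwistPol_of_rosatiPair [IsReduced S] [IsLocallyNoetherian S] (hN : N ≠ 0) (hP : E' * P = P) (hQ : Q * E' = Q)
    (hQP : Q * P = Matrix.scalar (Fin 1) (N : O)) (hPQ : P * Q = Matrix.scalar (Fin m) (N : O) * E')
    {𝔭 : Ideal O} (h𝔭 : Ideal.span (Set.range fun k => P k 0) = 𝔭) {a b : O}
    (hab : haveI := act.isMonHom b; act.i a ≫ pol.lam = pol.lam ≫ DualPair.dualIsogenyOver (act.i b) D D)
    (ha : 1 - a ∈ 𝔭) (hb : b ∈ 𝔭) :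
    ∃! lam' : (serreTensor act E' hE').X ⟶ Db.hat.X, IsMonHom lam' ∧ IsExactTwistPol act E' hE' P D Db pol N lam' := by
  obtain ⟨lam', hmon, hex, -⟩ := exists_isExactTwistPol_of_rosatiPair act E' hE' P Q D Db hD hDb pol hN hP hQ hQP hPQ h𝔭 hab ha hb
  refine ⟨lam', ⟨hmon, hex⟩, fun lam'' h'' => ?_⟩
  haveI := hmon
  haveI := h''.1
  exact IsExactTwistPol.eq act E' hE' P Q D Db hDb pol hN hP hQ hQP hPQ h''.2 hex

end AbelianSchemeOver

end Literature.AlgebraicGeometry.AbelianSchemes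

end
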